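import Summits.RiemannHypothesis.RiemannHypothesis.Theorems.PfPersistenceWindowClasses
import Summits.RiemannHypothesis.RiemannHypothesis.Theorems.PfPersistenceArithDialSpace
import HarnessLib

/-!
# PF persistence — the look-ahead classes `𝒞_look(k)` as SET-LEVEL defs (pub-rhpf, barrier-typer gen 3)

**HONEST FRAMING. This is a long-odds MECHANISM SEARCH; no RH claims.** RH-free bookkeeping only.

QUESTION A45 (2) (lead gen 6) / GAP row C8-N3 (cand-8): is the `k`-window LOOK-AHEAD conjunction
`K(w) = ⋀_{j<k} S₁(w^{(j)})` of ONE single-window reader `S₁` (read at the anchor `w = (a₀, N)` and at the next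
`k - 1` windows `(a₀ + j·h, N)`, same truncation) typable as a class with `k` as a parameter, and where does it sit?
Answer (TYPED here): `lookAheadClassAt k win₀ h S₁` is determined by `k` named windows (`isLk_lookAheadClassAt`,
PROVED), hence `FinitelyDetermined`, hence closed for GLOBAL separation on the arithmetic domain of record by the
locality barrier (`not_separates_lookAheadClassAt`, PROVED; witness a heavy prime dial ABOVE the `k` windows); the
conjunction over a FINITE set of anchors (the served grid) is still finitely determined (`lookAheadClassOn`,
`not_separates_lookAheadClassOn`, PROVED). The TOP-FREE conjunction over ALL anchors (`lookAheadClassAll`) reads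
windows of every height: it is outside the locality barrier's class as typed, and no theorem here closes it — its
per-window content is DATA (density closures) or a `G1` question when the reader is continuous.
-/

set_option linter.dupNamespace false  -- the mandated namespace repeats `RiemannHypothesis`

noncomputable section

open Real Finset Matrix

namespace Summit.RiemannHypothesis.RiemannHypothesis.Theorems.PfPersistence

/-- the `j`-th LOOK-AHEAD WINDOW above the anchor `win₀` with step `h ≥ 0`: `(a₀ + j·h, N₀)` (same truncation).
[folklore] -/
def Window.lookAhead (win₀ : Window) (h : ℝ) (hh : 0 ≤ h) (j : ℕ) : Window :=
  win₀.stepUp (j * h) (mul_nonneg j.cast_nonneg hh)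

/-- the truncation is unchanged along the look-ahead. [folklore] -/
@[simp] theorem Window.lookAhead_N (win₀ : Window) (h : ℝ) (hh : 0 ≤ h) (j : ℕ) :
    (win₀.lookAhead h hh j).N = win₀.N := rfl

/-- a SINGLE-WINDOW READER as a family of sets of window matrices (membership of `d win` in `S₁ win` is the reader's
verdict at `win`; any tier: sign-blind magnitude laws, shape∧scale conjunctions, ε₁-readers …). [folklore] -/
abbrev WindowReader : Type := (win : Window) → Set (Matrix (Fin (win.N + 1)) (Fin (win.N + 1)) ℝ)

/-- **`𝒞_look(k)` AT AN ANCHOR** (C8-N3, A45 (2)): the conjunction of the reader `S₁` over the `k` look-ahead windows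
`win₀, win₀ + h, …, win₀ + (k-1)h` (same `N`); `k` is a parameter. (A set-level class definition.) -/
def lookAheadClassAt (k : ℕ) (win₀ : Window) (h : ℝ) (hh : 0 ≤ h) (S₁ : WindowReader) : Set Datum :=
  {d | ∀ j < k, d (win₀.lookAhead h hh j) ∈ S₁ (win₀.lookAhead h hh j)}

/-- **`𝒞_look(k)` ON A FINITE ANCHOR SET** (the '∀ served anchor' conjunction: the served grid is finite). -/
def lookAheadClassOn (G : Finset Window) (k : ℕ) (h : ℝ) (hh : 0 ≤ h) (S₁ : WindowReader) : Set Datum :=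
  {d | ∀ win₀ ∈ G, d ∈ lookAheadClassAt k win₀ h hh S₁}

/-- **`𝒞_look(k)` TOP-FREE** (conjunction over ALL anchors): reads windows of every height — NOT finitely determined
in general; outside the locality barrier's class as typed; nothing below closes it. -/
def lookAheadClassAll (k : ℕ) (h : ℝ) (hh : 0 ≤ h) (S₁ : WindowReader) : Set Datum :=
  {d | ∀ win₀ : Window, d ∈ lookAheadClassAt k win₀ h hh S₁}

/-- PROVED: the nesting `𝒞_look(k') ⊆ 𝒞_look(k)` for `k ≤ k'` (more look-ahead, smaller class). [folklore] -/
theorem lookAheadClassAt_anti {k k' : ℕ} (hk : k ≤ k') (win₀ : Window) (h : ℝ) (hh : 0 ≤ h) (S₁ : WindowReader) :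
    lookAheadClassAt k' win₀ h hh S₁ ⊆ lookAheadClassAt k win₀ h hh S₁ :=
  fun _ hd j hj => hd j (lt_of_lt_of_le hj hk)

/-- PROVED: the top-free class is contained in every anchored / finite-anchor class. [folklore] -/
theorem lookAheadClassAll_subset_lookAheadClassOn (G : Finset Window) (k : ℕ) (h : ℝ) (hh : 0 ≤ h)
    (S₁ : WindowReader) : lookAheadClassAll k h hh S₁ ⊆ lookAheadClassOn G k h hh S₁ :=
  fun _ hd win₀ _ => hd win₀

/-- **PROVED: `𝒞_look(k)` at an anchor is `L_k`** — determined by its `k` named windows. [folklore] -/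
theorem isLk_lookAheadClassAt (k : ℕ) (win₀ : Window) (h : ℝ) (hh : 0 ≤ h) (S₁ : WindowReader) :
    IsLk (lookAheadClassAt k win₀ h hh S₁) k := by
  classical
  refine ⟨(Finset.range k).image (win₀.lookAhead h hh), Finset.card_image_le.trans (by simp), fun d d' hdd' => ?_⟩
  have hw : ∀ j < k, d (win₀.lookAhead h hh j) = d' (win₀.lookAhead h hh j) := fun j hj =>
    hdd' _ (Finset.mem_image_of_mem _ (Finset.mem_range.2 hj))
  simp only [lookAheadClassAt, Set.mem_setOf_eq]
  exact forall₂_congr fun j hj => by rw [hw j hj]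

/-- PROVED: hence finitely determined (inside the locality barrier's class). [folklore] -/
theorem lookAheadClassAt_finitelyDetermined (k : ℕ) (win₀ : Window) (h : ℝ) (hh : 0 ≤ h) (S₁ : WindowReader) :
    FinitelyDetermined (lookAheadClassAt k win₀ h hh S₁) :=
  (isLk_lookAheadClassAt k win₀ h hh S₁).finitelyDetermined

/-- **PROVED: the finite-anchor conjunction is finitely determined** (by the union of the `k`-window sets over the
anchors). [folklore] -/
theorem lookAheadClassOn_finitelyDetermined (G : Finset Window) (k : ℕ) (h : ℝ) (hh : 0 ≤ h) (S₁ : WindowReader) :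
    FinitelyDetermined (lookAheadClassOn G k h hh S₁) := by
  classical
  refine ⟨G.biUnion fun win₀ => (Finset.range k).image (win₀.lookAhead h hh), fun d d' hdd' => ?_⟩
  have hw : ∀ win₀ ∈ G, ∀ j < k, d (win₀.lookAhead h hh j) = d' (win₀.lookAhead h hh j) := fun win₀ hw₀ j hj =>
    hdd' _ (Finset.mem_biUnion.2 ⟨win₀, hw₀, Finset.mem_image_of_mem _ (Finset.mem_range.2 hj)⟩)
  simp only [lookAheadClassOn, lookAheadClassAt, Set.mem_setOf_eq]
  exact forall₂_congr fun win₀ hw₀ => forall₂_congr fun j hj => by rw [hw win₀ hw₀ j hj]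

/-- **PROVED — VERDICT (closed for GLOBAL separation, arithmetic domain of record):** no anchored look-ahead class
separates `ζ` from the detectably negative data on any domain `⊇ arithDialSpace`; the witness is a heavy PRIME dial
read ABOVE the `k` windows (so this never certifies a served-window negative — A45 (1)). [folklore] -/
theorem not_separates_lookAheadClassAt (k : ℕ) (win₀ : Window) (h : ℝ) (hh : 0 ≤ h) (S₁ : WindowReader)
    {D : Set Datum} (hD : arithDialSpace ⊆ D) : ¬ Separates (lookAheadClassAt k win₀ h hh S₁) D zetaDatum :=
  not_separates_of_finitelyDetermined_arith hD (lookAheadClassAt_finitelyDetermined k win₀ h hh S₁)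

/-- **PROVED — same verdict for the conjunction over any FINITE anchor set (e.g. the served grid).** [folklore] -/
theorem not_separates_lookAheadClassOn (G : Finset Window) (k : ℕ) (h : ℝ) (hh : 0 ≤ h) (S₁ : WindowReader)
    {D : Set Datum} (hD : arithDialSpace ⊆ D) : ¬ Separates (lookAheadClassOn G k h hh S₁) D zetaDatum :=
  not_separates_of_finitelyDetermined_arith hD (lookAheadClassOn_finitelyDetermined G k h hh S₁)

end Summit.RiemannHypothesis.RiemannHypothesis.Theorems.PfPersistence

end
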